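import Mathlib
import HarnessLib

/-!
# Lyapunov's obstruction: a block-diagonal weight needs Hurwitz diagonal blocks (instab g10, cell `ns-blowup`, 2026-08-26)

HONEST FRAMING (human ruling D-0035): nothing here is a claim about Navier–Stokes blow-up.
WHAT THIS IS NOT: not NS evidence. Kernel form of the STEP-0 exclusion of the float gate PART 3e
(`instab/INSTAB-BRIDGE.md` §13 l.124): if a Hermitian positive definite weight `W` makes the Hermitian
part of `W A` negative definite — `-(W A + Aᴴ W)` positive definite — then every eigenvalue of `A`
has negative real part. Contrapositively, a shell-diagonal block `A_jj` of the linearisation whose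
spectral abscissa is `≥ ω` admits NO positive weight `W_j` with `Herm(W_j (A_jj − ω)) ≺ 0`, so no
Lyapunov matrix that is block-diagonal by shells can certify the `H²` semigroup bound there (the easy
direction of Lyapunov's theorem; the quadratic form evaluated on an eigenvector).

Mathlib only; one theorem, no definitions.
-/

namespace Summit.NavierStokesRegularity.FluidComputer.LyapunovHurwitz

open Matrix
open scoped ComplexOrder ComplexConjugate

/-- **Lyapunov's obstruction.** If `W` is positive definite and `-(W A + Aᴴ W)` is positive definite
(the Hermitian part of `W A` is negative definite), then every eigenvalue `μ` of `A` satisfies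
`Re μ < 0`: for an eigenvector `x`, `xᴴ(W A + Aᴴ W)x = (μ + μ̄)·xᴴWx = 2 Re μ · xᴴWx`. -/
theorem re_lt_zero_of_lyapunov {n : Type*} [Fintype n] [DecidableEq n]
    {A W : Matrix n n ℂ} (hW : W.PosDef) (hN : (-(W * A + Aᴴ * W)).PosDef)
    {μ : ℂ} {x : n → ℂ} (hx : x ≠ 0) (hAx : A *ᵥ x = μ • x) : μ.re < 0 := by
  have hq : 0 < star x ⬝ᵥ (W *ᵥ x) := hW.dotProduct_mulVec_pos hx
  have hs : 0 < star x ⬝ᵥ ((-(W * A + Aᴴ * W)) *ᵥ x) := hN.dotProduct_mulVec_pos hx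
  set q : ℂ := star x ⬝ᵥ (W *ᵥ x) with hqdef
  have h1 : star x ⬝ᵥ ((W * A) *ᵥ x) = μ * q := by
    rw [← mulVec_mulVec, hAx, mulVec_smul, dotProduct_smul, smul_eq_mul]
  have h2 : star x ⬝ᵥ ((Aᴴ * W) *ᵥ x) = star μ * q := by
    rw [← mulVec_mulVec, dotProduct_mulVec, ← star_mulVec, hAx, star_smul, smul_dotProduct,
      smul_eq_mul]
  have hcalc : star x ⬝ᵥ ((-(W * A + Aᴴ * W)) *ᵥ x) = -((μ + star μ) * q) := by
    rw [neg_mulVec, dotProduct_neg, add_mulVec, dotProduct_add, h1, h2]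
    ring
  rw [hcalc] at hs
  -- `q` is a positive real, `μ + μ̄ = 2 Re μ`
  have hq_re : 0 < q.re := (Complex.lt_def.1 hq).1
  have hq_im : q.im = 0 := by simpa using (Complex.lt_def.1 hq).2.symm
  have hsum : μ + star μ = ((2 * μ.re : ℝ) : ℂ) := by
    rw [Complex.star_def, Complex.add_conj]
  have hre : (-((μ + star μ) * q)).re = -(2 * μ.re * q.re) := by
    rw [hsum]; simp [Complex.mul_re, hq_im]
  have hs_re : 0 < (-((μ + star μ) * q)).re := (Complex.lt_def.1 hs).1
  rw [hre] at hs_re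
  nlinarith

end Summit.NavierStokesRegularity.FluidComputer.LyapunovHurwitz
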